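import Literature.Probability.Percolation.SlabGluingFact2Boxes
import HarnessLib

/-!
# DST 2016, §2.3, Fact 2 — the surgery from a routing oracle, with boundary information

Topic: `Literature/Probability/Percolation`. Towards the verbatim discharge of
`DuminilCopinSidoraviciusTassion2016_fact2` (`SlabGluing.lean`). A sharpening of
`GlueGeom.exists_surgery_of_oracle` (`SlabGluingFact2Boxes.lean`): the routing oracle additionally
learns that the three vertices it has to connect sit on the BOUNDARY of the cleared set — `E₁` (the
first vertex of `γ_min(ω)` over `D`) has a `γ_min`-neighbour off `D̄`, `E₂` (the last one) has a
`γ_min`-neighbour off `D̄`, and the branch target `w'` (the last vertex over `D` of the witness path)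
either lies over `S'_n` or has a lattice neighbour over `B'_n ∖ D` off the columns of `γ_min(ω)`.
For the zone surgeries still owed (ends of `Z_n`, end of `γ_min`, next to `S_{3n}`) this confines
the endpoints inside the zone to its extreme rows (and the cell before the end of `γ_min`), which is
what makes their routing tractable.

* `GlueGeom.exists_surgery_of_oracle₂` — PROVED (the proof of `exists_surgery_of_oracle`, passing
  the predecessor of `E₁`, the successor of `E₂` and the successor of `w'` to the oracle).

## Sources

* H. Duminil-Copin, V. Sidoravicius, V. Tassion, *Absence of infinite cluster for critical
  Bernoulli percolation on slabs*, CPAM 69 (2016), arXiv:1401.7130, §2.3, proof of Fact 2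
  (construction of `ω^{(z)}`: `u'`, `v'` the first and last vertices of `γ_min(ω)` in
  `\overline{B_R}(z)`, `w'` on its boundary).
-/

noncomputable section

namespace Literature.Probability.Percolation

open LatticeModels SimpleGraph

variable {k : ℕ}

namespace GlueGeom

variable {G : GlueGeom}

/-- PROVED — **the local surgery from a routing oracle, with boundary information** (see the
module docstring; otherwise verbatim `exists_surgery_of_oracle`). [cite: DuminilCopinSidoraviciusTassion2016, §2.3, proof of Fact 2 (construction of ω^{(z)})] -/
theorem exists_surgery_of_oracle₂ {ω : BondConfig (slab 3 k)} (hω : ω ⊆ (slabGraph 3 k).edgeSet)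
    (hX : ω ∈ G.evX k) {D RP : Set (ℤ × ℤ)} (hDreg : D ⊆ G.big ∪ G.small) (hRPD : RP ⊆ D)
    (hRPbig : RP ⊆ G.big) (hRPZ : ∀ q ∈ RP, q ∉ G.zSeg)
    (hRP : ∀ q ∈ D, q ∈ G.big → q ∉ G.zSeg → q ∈ RP)
    {z : ℤ × ℤ} (hzD : z ∈ D) (hzγ : z ∈ G.γcols k ω)
    (hnbr : ∃ q₀ : ℤ × ℤ, ∀ q, planarAdj z q → q ∈ G.big → q ∉ D → q = q₀)
    (hfirst : ∀ v ∈ (G.γmin k ω).head?, planar k v ∉ D)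
    (hlast : ∀ v ∈ (G.γmin k ω).getLast?, planar k v ∉ D)
    {x₀ s' : slab 3 k} (hx₀D : planar k x₀ ∈ D) (hs' : s' ∈ slabLift k G.src')
    (hπ : ω ∈ openConnIn (slabLift k G.small ∩ {v | planar k v ∉ G.γcols k ω}) x₀ s')
    (oracle : ∀ E₁ E₂ w' : slab 3 k, planar k E₁ ∈ RP → planar k E₂ ∈ RP → planar k w' ∈ D →
      E₁ ≠ E₂ → planar k E₁ ≠ planar k w' → planar k E₂ ≠ planar k w' →
      E₁ ∈ G.γmin k ω → E₂ ∈ G.γmin k ω →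
      (∃ u ∈ G.γmin k ω, (slabGraph 3 k).Adj u E₁ ∧ planar k u ∉ D) →
      (∃ w ∈ G.γmin k ω, (slabGraph 3 k).Adj E₂ w ∧ planar k w ∉ D) →
      (planar k w' ∈ G.src' ∨ ∃ v, (slabGraph 3 k).Adj w' v ∧ planar k v ∈ G.small ∧
        planar k v ∉ D ∧ planar k v ∉ G.γcols k ω) →
      ∃ (L Br : List (slab 3 k)) (c : slab 3 k), RouteSpec k RP D E₁ E₂ w' L Br c ∧
        ∀ v ∈ L.tail.dropLast ++ Br.dropLast, v ∈ slabLift k G.src → v ∉ G.γmin k ω →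
          ∀ b ∈ (G.γmin k ω).head?, vKey k b ≤ vKey k v) :
    ∃ sg : G.Surgery k ω, sg.D = D := by
  classical
  have hA : ω ∈ G.evA k := hX.1.1.1
  obtain ⟨hγO, -⟩ := G.γmin_spec k hA
  set γ := G.γmin k ω with hγdef
  obtain ⟨g, hgγ, hgz⟩ := hzγ
  rw [← hγdef] at hgγ
  have hγmp : minPath k ω (slabLift k G.big) (slabLift k G.src) (slabLift k G.zSeg) = γ := rfl
  have hzbig : z ∈ G.big := by rw [← hgz]; exact hγO.subset g hgγ
  have hS := G.big_finite k
  have hex : ∃ l, IsOSAP k ω (slabLift k G.big) (slabLift k G.src) (slabLift k G.zSeg) l :=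
    (mem_slabConn_iff_exists_isOSAP ω _ _ _).1 hA
  have hlastD : ∀ v, γ.getLast? = some v → planar k v ∉ D := fun v hv => hlast v (Option.mem_def.2 hv)
  -- first visit of `γ` to `D̄`
  obtain ⟨p₀, E₁, rest₁, hγ1, hE₁D, hp₀D⟩ :=
    exists_first_split (p := fun x => planar k x ∈ D) γ ⟨g, hgγ, by rw [hgz]; exact hzD⟩
  have hp₀ : p₀ ≠ [] := by
    rintro rfl
    exact hfirst E₁ (by rw [hγ1]; rfl) hE₁D
  have hrest₁ : rest₁ ≠ [] := by
    rintro rfl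
    exact hlastD E₁ (by rw [hγ1]; simp) hE₁D
  -- `γ` visits `D̄` again after `E₁`
  have hmeet : ∃ x ∈ rest₁, planar k x ∈ D := by
    by_contra hno
    push Not at hno
    obtain ⟨q₀, hq₀⟩ := hnbr
    have hgE₁ : g = E₁ := by
      rw [hγ1] at hgγ
      rcases List.mem_append.1 hgγ with h | h
      · exact absurd (hgz ▸ hzD) (hp₀D g h)
      · rcases List.mem_cons.1 h with h | h
        · exact h
        · exact absurd (hgz ▸ hzD) (hno g h)
    have hch := hγO.chain
    rw [hγ1, List.isChain_append] at hch
    obtain ⟨-, hch2, hlink⟩ := hch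
    set u := p₀.getLast hp₀ with hu'
    set w := rest₁.head hrest₁ with hw
    have huE : s(u, E₁) ∈ ω := (hlink u (by rw [List.getLast?_eq_some_getLast hp₀]; rfl) E₁ (by simp)).1
    have hEw : s(E₁, w) ∈ ω := by
      rw [List.isChain_cons] at hch2
      exact (hch2.1 w (by rw [List.head?_eq_some_head hrest₁]; rfl)).1
    have hup₀ : u ∈ p₀ := List.getLast_mem hp₀
    have hwr : w ∈ rest₁ := List.head_mem hrest₁
    have huγ : u ∈ γ := by rw [hγ1]; exact List.mem_append_left _ hup₀
    have hwγ : w ∈ γ := by rw [hγ1]; simp [hwr]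
    have hadj₁ := (slab_adj_iff _ _).1 ((SimpleGraph.mem_edgeSet _).1 (hω huE))
    have hadj₂ := (slab_adj_iff _ _).1 ((SimpleGraph.mem_edgeSet _).1 (hω hEw))
    have hpE₁ : planar k E₁ = z := by rw [← hgE₁]; exact hgz
    rw [hpE₁] at hadj₁ hadj₂
    have hu1 : planar k u = q₀ := by
      rcases hadj₁ with ⟨-, hpa⟩ | ⟨hpe, -⟩
      · exact hq₀ _ (planarAdj_symm hpa) (hγO.subset u huγ) (hp₀D u hup₀)
      · exact absurd (hpe ▸ hzD) (hp₀D u hup₀)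
    have hw1 : planar k w = q₀ := by
      rcases hadj₂ with ⟨-, hpa⟩ | ⟨hpe, -⟩
      · exact hq₀ _ hpa (hγO.subset w hwγ) (hno w hwr)
      · exact absurd (hpe ▸ hzD) (hno w hwr)
    have hht : ht u = ht w := by
      rcases hadj₁ with ⟨h1, -⟩ | ⟨hpe, -⟩
      · rcases hadj₂ with ⟨h2, -⟩ | ⟨hpe, -⟩
        · omega
        · exact absurd (hpe ▸ hzD) (hno w hwr)
      · exact absurd (hpe ▸ hzD) (hp₀D u hup₀)
    have huw : u = w := (slab_ext_iff u w).2 ⟨hu1.trans hw1.symm, hht⟩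
    have hnd := hγO.nodup
    rw [hγ1, List.nodup_append] at hnd
    exact hnd.2.2 u hup₀ w (List.mem_cons_of_mem _ hwr) huw
  -- last visit of `γ` to `D̄`
  obtain ⟨mid, E₂, s₀, hrest, hE₂D, hs₀D⟩ := exists_last_split (p := fun x => planar k x ∈ D) rest₁ hmeet
  have hγeq : γ = p₀ ++ E₁ :: (mid ++ E₂ :: s₀) := by rw [hγ1, hrest]
  have hs₀ : s₀ ≠ [] := by
    rintro rfl
    have : γ = (p₀ ++ E₁ :: mid) ++ [E₂] := by rw [hγeq]; simp
    exact hlastD E₂ (by rw [this, List.getLast?_concat]) hE₂D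
  have hE₁₂ : E₁ ≠ E₂ := by
    intro h
    have hnd := hγO.nodup
    rw [hγeq, List.nodup_append] at hnd
    have := (List.nodup_cons.1 hnd.2.1).1
    exact this (by rw [h]; simp)
  -- `E₁`, `E₂` are off `Z_n`
  have hE₁Z : planar k E₁ ∉ G.zSeg := by
    have h := minPath_prefix_getLast_not_mem hS hex (p := p₀ ++ [E₁]) (s := mid ++ E₂ :: s₀)
      (by rw [hγmp, hγeq]; simp) (by simp) (by simp)
    simpa using h
  have hE₂Z : planar k E₂ ∉ G.zSeg := by
    have h := minPath_prefix_getLast_not_mem hS hex (p := p₀ ++ E₁ :: mid ++ [E₂]) (s := s₀)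
      (by rw [hγmp, hγeq]; simp) hs₀ (by simp)
    simpa using h
  have hE₁γ : E₁ ∈ γ := by rw [hγeq]; simp
  have hE₂γ : E₂ ∈ γ := by rw [hγeq]; simp
  have hE₁RP : planar k E₁ ∈ RP := hRP _ hE₁D (hγO.subset E₁ hE₁γ) hE₁Z
  have hE₂RP : planar k E₂ ∈ RP := hRP _ hE₂D (hγO.subset E₂ hE₂γ) hE₂Z
  -- the witness path `π` of (P2) and its last vertex `w'` in `D̄`
  obtain ⟨π, hπO⟩ := exists_isOSAP_of_openConnIn hπ
  have hx₀π : x₀ ∈ π := by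
    have := hπO.head_mem hπO.ne_nil
    rw [Set.mem_singleton_iff] at this
    rw [← this]; exact List.head_mem _
  obtain ⟨πpre, w', sgt, hπeq, hw'D, hsgtD⟩ :=
    exists_last_split (p := fun x => planar k x ∈ D) π ⟨x₀, hx₀π, hx₀D⟩
  have hw'π : w' ∈ π := by rw [hπeq]; simp
  have hw'γ : planar k w' ∉ G.γcols k ω := (hπO.subset w' hw'π).2
  have hw'E₁ : planar k E₁ ≠ planar k w' := fun h => hw'γ ⟨E₁, hE₁γ, h⟩
  have hw'E₂ : planar k E₂ ≠ planar k w' := fun h => hw'γ ⟨E₂, hE₂γ, h⟩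
  -- routing
  have hπch := hπO.chain
  rw [hπeq, List.isChain_append] at hπch
  -- boundary information: the neighbours of `E₁`, `E₂`, `w'` outside `D̄`
  have hpred : ∃ u ∈ G.γmin k ω, (slabGraph 3 k).Adj u E₁ ∧ planar k u ∉ D := by
    have hchγ := hγO.chain
    rw [hγeq, List.isChain_append] at hchγ
    obtain ⟨-, -, hlink⟩ := hchγ
    have huE : s(p₀.getLast hp₀, E₁) ∈ ω :=
      (hlink _ (by rw [List.getLast?_eq_some_getLast hp₀]; rfl) E₁ (by simp)).1
    refine ⟨p₀.getLast hp₀, ?_, (SimpleGraph.mem_edgeSet _).1 (hω huE), hp₀D _ (List.getLast_mem _)⟩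
    change p₀.getLast hp₀ ∈ γ
    rw [hγeq]; exact List.mem_append_left _ (List.getLast_mem _)
  have hsucc : ∃ w ∈ G.γmin k ω, (slabGraph 3 k).Adj E₂ w ∧ planar k w ∉ D := by
    have hchγ := hγO.chain
    have : γ = (p₀ ++ E₁ :: mid) ++ (E₂ :: s₀) := by rw [hγeq]; simp
    rw [this, List.isChain_append] at hchγ
    obtain ⟨-, hch3, -⟩ := hchγ
    rw [List.isChain_cons] at hch3
    have hEw : s(E₂, s₀.head hs₀) ∈ ω := (hch3.1 _ (by rw [List.head?_eq_some_head hs₀]; rfl)).1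
    refine ⟨s₀.head hs₀, ?_, (SimpleGraph.mem_edgeSet _).1 (hω hEw), hs₀D _ (List.head_mem _)⟩
    change s₀.head hs₀ ∈ γ
    rw [hγeq]; simp [List.head_mem]
  have hwnext : planar k w' ∈ G.src' ∨ ∃ v, (slabGraph 3 k).Adj w' v ∧ planar k v ∈ G.small ∧
      planar k v ∉ D ∧ planar k v ∉ G.γcols k ω := by
    by_cases hsgt : sgt = []
    · left
      subst hsgt
      have hlast := hπO.last_mem hπO.ne_nil
      rw [Set.mem_singleton_iff] at hlast
      have : π.getLast hπO.ne_nil = w' := by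
        rw [List.getLast_congr _ (by simp) hπeq]; simp
      rw [← this, hlast]; exact hs'
    · right
      have hch := hπch.2.1
      rw [List.isChain_cons] at hch
      have hrel := hch.1 _ (by rw [List.head?_eq_some_head hsgt]; rfl)
      have hvπ : sgt.head hsgt ∈ π := by rw [hπeq]; simp [List.head_mem]
      exact ⟨sgt.head hsgt, (SimpleGraph.mem_edgeSet _).1 (hω hrel.1), (hπO.subset _ hvπ).1,
        hsgtD _ (List.head_mem _), (hπO.subset _ hvπ).2⟩
  obtain ⟨L, Br, c, spec, hkey⟩ := oracle E₁ E₂ w' hE₁RP hE₂RP hw'D hE₁₂ hw'E₁ hw'E₂ hE₁γ hE₂γ hpred hsucc hwnext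
  set P := L.tail.dropLast with hP
  have hLeq : L = E₁ :: (P ++ [E₂]) := spec.hL.eq_cons_dropLast_concat hE₁₂
  have hPL : ∀ v ∈ P, v ∈ L := fun v hv => by
    rw [hLeq]; exact List.mem_cons_of_mem _ (List.mem_append_left _ hv)
  have hBrlast : Br.getLast spec.hBr = w' := by
    have h1 := spec.hCB.last
    rw [List.getLast?_cons, List.getLast?_eq_some_getLast spec.hBr] at h1
    simpa using h1
  -- the `S'`-side path `σ = w' :: sgt`
  refine ⟨⟨D, p₀, E₁, mid, E₂, s₀, P, c, Br, w' :: sgt,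
    hDreg, hγeq, hp₀, hs₀, hp₀D, hs₀D, hE₁D, hE₂D,
    fun x hx => hRPD (spec.hL_sub x (hPL x hx)),
    fun x hx => hRPbig (spec.hL_sub x (hPL x hx)),
    fun x hx => hRPZ _ (spec.hL_sub x (hPL x hx)),
    hLeq ▸ spec.hL.chain, hLeq ▸ spec.hL.nodup,
    ?_, spec.hBr, spec.hBr_sub,
    spec.hCB.chain.imp fun a b h => h, spec.hCB.nodup,
    fun x hx => hLeq ▸ spec.hBr_L x hx,
    fun l₁ l₂ y h => spec.hfwd l₁ l₂ y (hLeq.trans h) _ (List.head?_eq_some_head spec.hBr ▸ rfl),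
    fun v hv => hkey v hv, (by rw [hBrlast]; rfl), hπch.2.1,
    fun x hx => (hπO.subset x (by rw [hπeq]; exact List.mem_append_right _ hx)).1,
    fun x hx => (hπO.subset x (by rw [hπeq]; exact List.mem_append_right _ hx)).2,
    hsgtD,
    fun h => ?_⟩, rfl⟩
  · -- `c ∈ E₁ :: P`
    have hc := spec.hc
    rw [hLeq] at hc
    simp only [List.mem_cons, List.mem_append, List.not_mem_nil, or_false] at hc ⊢
    rcases hc with h | h | h
    · exact Or.inl h
    · exact Or.inr h
    · exact absurd h spec.hcE₂
  · -- `σ` ends in `S̄'_n`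
    have := hπO.last_mem hπO.ne_nil
    rw [Set.mem_singleton_iff] at this
    have h2 : (w' :: sgt).getLast h = π.getLast hπO.ne_nil := by
      rw [List.getLast_congr _ (by simp) hπeq, List.getLast_append_of_ne_nil _ (List.cons_ne_nil _ _)]
    rw [h2, this]; exact hs'

end GlueGeom

end Literature.Probability.Percolation

end
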